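import Literature.NumberTheory.Automorphic.OpenBruhatCellGL
import Literature.NumberTheory.Automorphic.ParabolicInductionLeviCartanProofs
import Literature.NumberTheory.Automorphic.ParabolicInductionProofs
import HarnessLib

/-!
# The Levi relation of a Whittaker functional, block by block

Topic `NumberTheory/Automorphic`. Let `c : Fin n → Fin r` be a monotone block labelling,
`P = P_c ≤ GL_n(F)` the standard parabolic with Levi `M = Π_a GL(B_a, F)` (`B_a = {i // c i = a}`,
an interval of `Fin n`), `w₀ = permGL Fin.revPerm` and `A' = cellLeviUnipotent c = U_n ∩ w₀⁻¹ P w₀`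
(`OpenBruhatCellGL`). The heredity theorem (`WhittakerHeredityGL`) produces linear forms `l` on the
space of a representation `σ` of `M` satisfying the **cell relation**

  `l (σ'(w₀ m w₀⁻¹) w) = ψ_U(m) · l w` for all `m ∈ A'`, where `σ' = (σ ∘ proj) ⊗ δ_P^{1/2}`.

Here we unwind this relation block by block. For a block `a` let
`ẽ_a = blockEnumRev c a : Fin n_a ≃ B_a` be the *decreasing* enumeration of `B_a` and, for
`u ∈ GL_{n_a}(F)`, let `cellLeviElt c a u = w₀⁻¹ · diag(1, …, ẽ_a u ẽ_a⁻¹, …, 1) · w₀ ∈ GL_n(F)`.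
We prove:

* `cellLeviElt_mem_cellLeviUnipotent` — for `u ∈ U_{n_a}` upper unitriangular,
  `cellLeviElt c a u ∈ A'` (it is upper unitriangular: `ẽ_a` is decreasing and `w₀` reverses);
* `superdiagSum_cellLeviElt` — `∑_i (cellLeviElt c a u)_{i,i+1} = ∑_k u_{k,k+1}` (the blocks of a
  monotone labelling are intervals, so consecutive indices correspond: `blockEnum_succ_iff`),
  hence `ψ_U (cellLeviElt c a u) = ψ_{U_{n_a}}(u)`;
* `rootDeltaChar_leviEmbeddingP_mulSingle_eq_one` — `δ_P^{1/2}` is trivial on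
  `diag(1, …, ẽ_a u ẽ_a⁻¹, …, 1)` for unitriangular `u` (every homomorphism to a commutative group
  kills `U_{n_a}`, `map_eq_one_of_mem_unipotentRadicalP` via `map_upperUnitriangular_eq_one_of_commGroup`);
* `apply_mulSingle_reindexGL_of_cell_relation` — **the Levi relation block by block**: a linear
  form satisfying the cell relation satisfies
  `l (σ (mulSingle a (ẽ_a u ẽ_a⁻¹)) w) = ψ_{U_{n_a}}(u) · l w` for every block `a` and every
  `u ∈ U_{n_a}(F)` — i.e. it is a Whittaker functional, for the standard character, of each
  `GL_{n_a}`-factor in the coordinates `ẽ_a`.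

This is the bookkeeping step "`θ|_{U ∩ M} = ∏ θ_a`" of Bernstein–Zelevinsky 1977, §4.7 (proof
that `(ρ₁ × … × ρ_r)^{(n)} = ρ₁^{(n₁)} ⊗ … ⊗ ρ_r^{(n_r)}` in top degree) in the `w₀`-conjugated
coordinates used by `WhittakerHeredityGL`. Definitions with bodies (`blockEnumRev`,
`cellLeviElt`); theorems otherwise; no named fact.

## References

* I. N. Bernstein, A. V. Zelevinsky, *Induced representations of reductive `p`-adic groups I*,
  Ann. Sci. ÉNS 10 (1977), §4.7. [BernsteinZelevinskyASENS1977]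
-/

noncomputable section

open Matrix

namespace Literature.NumberTheory.Automorphic

/-! ### Blocks of a monotone labelling are intervals -/

section Blocks

variable {n r : ℕ} (c : Fin n → Fin r)

/-- **Consecutive elements of a block are consecutive indices**: for a monotone labelling `c`
the increasing enumeration `blockEnum c a : Fin n_a ≃o B_a` satisfies
`blockEnum (k+1) = blockEnum k + 1` — the block `B_a` is an interval of `Fin n`. [folklore] -/
theorem blockEnum_succ_iff (hc : Monotone c) (a : Fin r) (p q : Fin (Fintype.card {i // c i = a})) :
    (((blockEnum c a p : {i // c i = a}) : Fin n) : ℕ) + 1 = ((blockEnum c a q : {i // c i = a}) : Fin n) ↔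
      (p : ℕ) + 1 = q := by
  set E := blockEnum c a with hE
  constructor
  · intro h
    have hpq : p < q := by
      have : E p < E q := by
        change ((E p : {i // c i = a}) : Fin n) < ((E q : {i // c i = a}) : Fin n)
        rw [Fin.lt_def]
        omega
      exact E.lt_iff_lt.1 this
    by_contra hne
    have hlt : (p : ℕ) + 1 < q := by
      have := Fin.lt_def.1 hpq
      omega
    set k : Fin (Fintype.card {i // c i = a}) := ⟨(p : ℕ) + 1, lt_trans hlt q.2⟩ with hk
    have h1 : E p < E k := E.lt_iff_lt.2 (Fin.lt_def.2 (by simp [hk]))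
    have h2 : E k < E q := E.lt_iff_lt.2 (Fin.lt_def.2 (by simp [hk]; exact hlt))
    have h1' : (((E p : {i // c i = a}) : Fin n) : ℕ) < ((E k : {i // c i = a}) : Fin n) := h1
    have h2' : (((E k : {i // c i = a}) : Fin n) : ℕ) < ((E q : {i // c i = a}) : Fin n) := h2
    omega
  · intro h
    have hpq : p < q := Fin.lt_def.2 (by omega)
    have hlt : E p < E q := E.lt_iff_lt.2 hpq
    have hlt' : (((E p : {i // c i = a}) : Fin n) : ℕ) < ((E q : {i // c i = a}) : Fin n) := hlt
    by_contra hne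
    have hlt2 : (((E p : {i // c i = a}) : Fin n) : ℕ) + 1 < ((E q : {i // c i = a}) : Fin n) := by omega
    -- the index strictly between lies in the block
    set z : Fin n := ⟨(((E p : {i // c i = a}) : Fin n) : ℕ) + 1,
      lt_trans hlt2 ((E q : {i // c i = a}) : Fin n).2⟩ with hz
    have hz1 : ((E p : {i // c i = a}) : Fin n) ≤ z := Fin.le_def.2 (by simp [hz])
    have hz2 : z ≤ ((E q : {i // c i = a}) : Fin n) := Fin.le_def.2 (by simp [hz]; omega)
    have hcz : c z = a := by
      have h₁ : c ((E p : {i // c i = a}) : Fin n) ≤ c z := hc hz1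
      have h₂ : c z ≤ c ((E q : {i // c i = a}) : Fin n) := hc hz2
      rw [(E p).2] at h₁
      rw [(E q).2] at h₂
      exact le_antisymm h₂ h₁
    set k := E.symm ⟨z, hcz⟩ with hk
    have hEk : E k = ⟨z, hcz⟩ := by rw [hk, OrderIso.apply_symm_apply]
    have hk1 : p < k := by
      rw [← E.lt_iff_lt, hEk]
      change ((E p : {i // c i = a}) : Fin n) < z
      exact Fin.lt_def.2 (by simp [hz])
    have hk2 : k < q := by
      rw [← E.lt_iff_lt, hEk]
      change z < ((E q : {i // c i = a}) : Fin n)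
      exact Fin.lt_def.2 hlt2
    have := Fin.lt_def.1 hk1
    have := Fin.lt_def.1 hk2
    omega

/-- The **decreasing enumeration** `Fin n_a ≃ B_a` of the block `B_a`, `k ↦ blockEnum (rev k)`.
In these coordinates, lower unitriangular matrices of `GL(B_a)` become upper unitriangular
matrices of `GL_{n_a}`. [folklore] -/
def blockEnumRev (a : Fin r) : Fin (Fintype.card {i // c i = a}) ≃ {i // c i = a} :=
  Fin.revPerm.trans (blockEnum c a).toEquiv

/-- `blockEnumRev c a k = blockEnum c a (rev k)`. [folklore] -/
@[simp] lemma blockEnumRev_apply (a : Fin r) (k : Fin (Fintype.card {i // c i = a})) :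
    blockEnumRev c a k = blockEnum c a (Fin.rev k) := rfl

/-- `(blockEnumRev c a)⁻¹ p = rev (blockEnum⁻¹ p)`. [folklore] -/
lemma blockEnumRev_symm_apply (a : Fin r) (p : {i // c i = a}) :
    (blockEnumRev c a).symm p = Fin.rev ((blockEnum c a).symm p) := rfl

/-- `blockEnumRev` is strictly decreasing. [folklore] -/
lemma blockEnumRev_lt_iff (a : Fin r) (k l : Fin (Fintype.card {i // c i = a})) :
    blockEnumRev c a k < blockEnumRev c a l ↔ l < k := by
  rw [blockEnumRev_apply, blockEnumRev_apply, (blockEnum c a).lt_iff_lt, Fin.rev_lt_rev]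

end Blocks

/-! ### The element `w₀⁻¹ diag(1, …, ẽ u ẽ⁻¹, …, 1) w₀` -/

section Element

variable {F : Type*} [Field F] {n r : ℕ} (c : Fin n → Fin r)

/-- The matrix `ẽ_a u ẽ_a⁻¹ ∈ GL(B_a, F)` placed in the block `a` of the Levi, embedded in `GL_n(F)`
block diagonally and conjugated by `w₀⁻¹`:
`cellLeviElt c a u = w₀⁻¹ · diag(1, …, ẽ_a u ẽ_a⁻¹, …, 1) · w₀`. [folklore] -/
def cellLeviElt (a : Fin r) (u : GL (Fin (Fintype.card {i // c i = a})) F) : GL (Fin n) F :=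
  (permGL Fin.revPerm)⁻¹ *
    blockDiagonalGL F c (Pi.mulSingle a (reindexGL (k := F) (blockEnumRev c a) u)) * permGL Fin.revPerm

variable {c}

/-- `w₀ (cellLeviElt c a u) w₀⁻¹ = diag(1, …, ẽ_a u ẽ_a⁻¹, …, 1)`. [folklore] -/
lemma permGL_mul_cellLeviElt_mul_inv (a : Fin r) (u : GL (Fin (Fintype.card {i // c i = a})) F) :
    permGL Fin.revPerm * cellLeviElt c a u * (permGL Fin.revPerm)⁻¹ =
      blockDiagonalGL F c (Pi.mulSingle a (reindexGL (k := F) (blockEnumRev c a) u)) := by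
  rw [cellLeviElt]
  group

/-- Entries of `cellLeviElt`: `(cellLeviElt c a u)_{ij} = diag(1, …, ẽ u ẽ⁻¹, …, 1)_{rev i, rev j}`. [folklore] -/
lemma cellLeviElt_apply (a : Fin r) (u : GL (Fin (Fintype.card {i // c i = a})) F) (i j : Fin n) :
    ((cellLeviElt c a u : GL (Fin n) F) : Matrix (Fin n) (Fin n) F) i j =
      ((blockDiagonalGL F c (Pi.mulSingle a (reindexGL (k := F) (blockEnumRev c a) u)) : GL (Fin n) F) :
        Matrix (Fin n) (Fin n) F) (Fin.rev i) (Fin.rev j) := by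
  have h : ((permGL Fin.revPerm * cellLeviElt c a u * (permGL Fin.revPerm)⁻¹ : GL (Fin n) F) :
      Matrix (Fin n) (Fin n) F) (Fin.rev i) (Fin.rev j) =
      ((blockDiagonalGL F c (Pi.mulSingle a (reindexGL (k := F) (blockEnumRev c a) u)) : GL (Fin n) F) :
        Matrix (Fin n) (Fin n) F) (Fin.rev i) (Fin.rev j) := by
    rw [permGL_mul_cellLeviElt_mul_inv]
  rw [← h, coe_permGL_mul_mul_inv, Matrix.submatrix_apply, Fin.revPerm_apply, Fin.revPerm_apply,
    Fin.rev_rev, Fin.rev_rev]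

/-- Entries of `diag(1, …, g, …, 1)` in the block `a`: `g_{pq}`. [folklore] -/
lemma blockDiagonalGL_mulSingle_apply_same (a : Fin r) (g : GL {i // c i = a} F) (p q : {i // c i = a}) :
    ((blockDiagonalGL F c (Pi.mulSingle a g) : GL (Fin n) F) : Matrix (Fin n) (Fin n) F) p q =
      (g : Matrix {i // c i = a} {i // c i = a} F) p q := by
  rw [blockDiagonalGL_apply_coe]
  have hp : (⟨c (p : Fin n), ⟨(p : Fin n), rfl⟩⟩ : Σ b, {k // c k = b}) = ⟨a, p⟩ := Sigma.subtype_ext p.2 rfl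
  have hq : (⟨c (q : Fin n), ⟨(q : Fin n), rfl⟩⟩ : Σ b, {k // c k = b}) = ⟨a, q⟩ := Sigma.subtype_ext q.2 rfl
  rw [hp, hq, Matrix.blockDiagonal'_apply_eq, Pi.mulSingle_eq_same]

/-- Entries of `diag(1, …, g, …, 1)` off the block `a`: those of the identity. [folklore] -/
lemma blockDiagonalGL_mulSingle_apply_of_ne (a : Fin r) (g : GL {i // c i = a} F) {p q : Fin n}
    (h : ¬ (c p = a ∧ c q = a)) :
    ((blockDiagonalGL F c (Pi.mulSingle a g) : GL (Fin n) F) : Matrix (Fin n) (Fin n) F) p q =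
      (1 : Matrix (Fin n) (Fin n) F) p q := by
  rw [blockDiagonalGL_apply_coe_dite]
  by_cases hpq : c p = c q
  · rw [dif_pos hpq]
    have hpa : c p ≠ a := fun hpa => h ⟨hpa, hpq ▸ hpa⟩
    rw [Pi.mulSingle_eq_of_ne hpa, Units.val_one, Matrix.one_apply, Matrix.one_apply]
    simp only [Subtype.mk.injEq]
  · rw [dif_neg hpq, Matrix.one_apply_ne]
    exact fun hpq' => hpq (congrArg c hpq')

/-- Entries of `cellLeviElt c a u` at two indices of the (reversed) block `a`, in the coordinates
`f k = rev (ẽ_a k)`: `(cellLeviElt c a u)_{f k, f l} = u_{kl}`. [folklore] -/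
lemma cellLeviElt_apply_rev_blockEnumRev (a : Fin r) (u : GL (Fin (Fintype.card {i // c i = a})) F)
    (k l : Fin (Fintype.card {i // c i = a})) :
    ((cellLeviElt c a u : GL (Fin n) F) : Matrix (Fin n) (Fin n) F)
        (Fin.rev ((blockEnumRev c a k : {i // c i = a}) : Fin n))
        (Fin.rev ((blockEnumRev c a l : {i // c i = a}) : Fin n)) =
      (u : Matrix _ _ F) k l := by
  rw [cellLeviElt_apply, Fin.rev_rev, Fin.rev_rev, blockDiagonalGL_mulSingle_apply_same, coe_reindexGL,
    Matrix.reindex_apply, Matrix.submatrix_apply, Equiv.symm_apply_apply, Equiv.symm_apply_apply]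

/-- If an entry `(cellLeviElt c a u)_{ij}` with `i ≠ j` is non-zero then `rev i, rev j ∈ B_a`. [folklore] -/
lemma rev_mem_of_cellLeviElt_apply_ne_zero (a : Fin r) (u : GL (Fin (Fintype.card {i // c i = a})) F)
    {i j : Fin n} (hij : i ≠ j)
    (h : ((cellLeviElt c a u : GL (Fin n) F) : Matrix (Fin n) (Fin n) F) i j ≠ 0) :
    c (Fin.rev i) = a ∧ c (Fin.rev j) = a := by
  by_contra hc
  rw [cellLeviElt_apply, blockDiagonalGL_mulSingle_apply_of_ne a _ hc, Matrix.one_apply_ne] at h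
  · exact h rfl
  · exact fun h' => hij (Fin.rev_injective h')

/-- **`cellLeviElt c a u` is upper unitriangular for `u ∈ U_{n_a}`**: the decreasing enumeration
`ẽ_a` turns `u` into a lower unitriangular matrix of `GL(B_a)` and the conjugation by `w₀` turns
it back. [folklore] -/
theorem cellLeviElt_mem_upperUnitriangular (a : Fin r) {u : GL (Fin (Fintype.card {i // c i = a})) F}
    (hu : u ∈ upperUnitriangular (Fin (Fintype.card {i // c i = a})) F) :
    cellLeviElt c a u ∈ upperUnitriangular (Fin n) F := by
  rw [mem_upperUnitriangular_iff] at hu ⊢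
  refine ⟨fun i j hij => ?_, fun i => ?_⟩
  · -- `j < i`
    change j < i at hij
    by_contra h
    obtain ⟨hi, hj⟩ := rev_mem_of_cellLeviElt_apply_ne_zero a u hij.ne' h
    set k := (blockEnumRev c a).symm ⟨Fin.rev i, hi⟩ with hk
    set l := (blockEnumRev c a).symm ⟨Fin.rev j, hj⟩ with hl
    have hik : Fin.rev ((blockEnumRev c a k : {i // c i = a}) : Fin n) = i := by
      rw [hk, Equiv.apply_symm_apply, Fin.rev_rev]
    have hjl : Fin.rev ((blockEnumRev c a l : {i // c i = a}) : Fin n) = j := by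
      rw [hl, Equiv.apply_symm_apply, Fin.rev_rev]
    rw [← hik, ← hjl, cellLeviElt_apply_rev_blockEnumRev] at h
    -- `l < k`... no: `k < l` as `ẽ k = rev i < rev j = ẽ l` means `l < k`; `u_{kl} = 0` for `l < k`
    have hkl : l < k := by
      rw [← blockEnumRev_lt_iff c a, hk, hl, Equiv.apply_symm_apply, Equiv.apply_symm_apply]
      exact Fin.rev_lt_rev.2 hij
    exact h (hu.1 hkl)
  · rw [cellLeviElt_apply]
    by_cases hi : c (Fin.rev i) = a
    · have := blockDiagonalGL_mulSingle_apply_same (c := c) a (reindexGL (k := F) (blockEnumRev c a) u)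
        ⟨Fin.rev i, hi⟩ ⟨Fin.rev i, hi⟩
      rw [this, coe_reindexGL, Matrix.reindex_apply, Matrix.submatrix_apply]
      exact hu.2 _
    · rw [blockDiagonalGL_mulSingle_apply_of_ne a _ (fun h => hi h.1), Matrix.one_apply_eq]

/-- **`cellLeviElt c a u ∈ A'`** for `u ∈ U_{n_a}`. [folklore] -/
theorem cellLeviElt_mem_cellLeviUnipotent (a : Fin r) {u : GL (Fin (Fintype.card {i // c i = a})) F}
    (hu : u ∈ upperUnitriangular (Fin (Fintype.card {i // c i = a})) F) :
    cellLeviElt c a u ∈ cellLeviUnipotent (K := F) c := by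
  rw [mem_cellLeviUnipotent_iff_conj_mem]
  refine ⟨cellLeviElt_mem_upperUnitriangular a hu, ?_⟩
  rw [permGL_mul_cellLeviElt_mul_inv]
  exact blockDiagonalGL_mem c _

/-- **The superdiagonal sum is preserved**: `∑_i (cellLeviElt c a u)_{i,i+1} = ∑_k u_{k,k+1}` for a
monotone labelling (the reversed block is an interval, on which `k ↦ rev (ẽ_a k)` is the increasing
enumeration; all other superdiagonal entries vanish). [folklore] -/
theorem superdiagSum_cellLeviElt (hc : Monotone c) (a : Fin r)
    (u : ↥(upperUnitriangular (Fin (Fintype.card {i // c i = a})) F)) :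
    superdiagSum ⟨cellLeviElt c a (u : GL _ F), cellLeviElt_mem_upperUnitriangular a u.2⟩ =
      superdiagSum u := by
  classical
  -- the increasing enumeration `f` of the reversed block
  obtain ⟨f, hf⟩ : ∃ f : Fin (Fintype.card {i // c i = a}) → Fin n,
      f = fun k => Fin.rev ((blockEnumRev c a k : {i // c i = a}) : Fin n) := ⟨_, rfl⟩
  have hf_inj : Function.Injective f := fun k l h => by
    rw [hf] at h
    exact (blockEnumRev c a).injective (Subtype.ext (Fin.rev_injective h))
  have hf_succ : ∀ k l : Fin (Fintype.card {i // c i = a}), (f k : ℕ) + 1 = f l ↔ (k : ℕ) + 1 = l := by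
    intro k l
    simp only [hf, blockEnumRev_apply, Fin.val_rev]
    have h1 := blockEnum_succ_iff c hc a (Fin.rev l) (Fin.rev k)
    simp only [Fin.val_rev] at h1
    have hb1 := ((blockEnum c a (Fin.rev k) : {i // c i = a}) : Fin n).2
    have hb2 := ((blockEnum c a (Fin.rev l) : {i // c i = a}) : Fin n).2
    have hk := k.2
    have hl := l.2
    omega
  have hval : ∀ k l : Fin (Fintype.card {i // c i = a}),
      ((cellLeviElt c a (u : GL _ F) : GL (Fin n) F) : Matrix (Fin n) (Fin n) F) (f k) (f l) =
      ((u : GL (Fin (Fintype.card {i // c i = a})) F) : Matrix _ _ F) k l := fun k l => by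
    rw [hf]
    exact cellLeviElt_apply_rev_blockEnumRev a _ k l
  have hfk : ∀ (i : Fin n) (hi : c (Fin.rev i) = a), f ((blockEnumRev c a).symm ⟨Fin.rev i, hi⟩) = i := by
    intro i hi
    simp only [hf, Equiv.apply_symm_apply, Fin.rev_rev]
  rw [superdiagSum_def, superdiagSum_def,
    ← Finset.sum_product' Finset.univ Finset.univ (fun (i : Fin n) (j : Fin n) => if (i : ℕ) + 1 = (j : ℕ) then
      ((cellLeviElt c a (u : GL _ F) : GL (Fin n) F) : Matrix _ _ F) i j else 0),
    ← Finset.sum_product' Finset.univ Finset.univ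
      (fun (k : Fin (Fintype.card {i // c i = a})) (l : Fin (Fintype.card {i // c i = a})) =>
        if (k : ℕ) + 1 = (l : ℕ) then ((u : GL (Fin (Fintype.card {i // c i = a})) F) : Matrix _ _ F) k l else 0)]
  symm
  refine Finset.sum_bij_ne_zero (fun kl _ _ => (f kl.1, f kl.2)) (fun _ _ _ => Finset.mem_univ _)
    (fun kl _ _ kl' _ _ h => ?_) (fun ij _ hij => ?_) (fun kl _ _ => ?_)
  · simp only [Prod.mk.injEq] at h
    exact Prod.ext (hf_inj h.1) (hf_inj h.2)
  · -- surjectivity onto the support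
    obtain ⟨i, j⟩ := ij
    simp only [ne_eq, ite_eq_right_iff, Classical.not_imp] at hij
    obtain ⟨hij1, hij2⟩ := hij
    have hne : i ≠ j := fun h => by subst h; omega
    obtain ⟨hi, hj⟩ := rev_mem_of_cellLeviElt_apply_ne_zero a _ hne hij2
    refine ⟨((blockEnumRev c a).symm ⟨Fin.rev i, hi⟩, (blockEnumRev c a).symm ⟨Fin.rev j, hj⟩),
      Finset.mem_univ _, ?_, ?_⟩
    · rw [ne_eq, ite_eq_right_iff, Classical.not_imp, ← hf_succ, hfk i hi, hfk j hj, ← hval, hfk i hi, hfk j hj]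
      exact ⟨hij1, hij2⟩
    · rw [Prod.mk.injEq, hfk i hi, hfk j hj]
      exact ⟨rfl, rfl⟩
  · -- values agree
    obtain ⟨k, l⟩ := kl
    simp only [hval, hf_succ]

/-- `ψ_U (cellLeviElt c a u) = ψ_{U_{n_a}}(u)`. [folklore] -/
theorem whittakerCharFun_cellLeviElt (hc : Monotone c) (ψ : AddChar F Circle) (a : Fin r)
    (u : ↥(upperUnitriangular (Fin (Fintype.card {i // c i = a})) F)) :
    whittakerCharFun ψ ⟨cellLeviElt c a (u : GL _ F), cellLeviElt_mem_upperUnitriangular a u.2⟩ =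
      whittakerCharFun ψ u := by
  rw [whittakerCharFun_apply, whittakerCharFun_apply, superdiagSum_cellLeviElt hc]

end Element

/-! ### Triviality of `δ^{1/2}` on unitriangular Levi elements and the Levi relation -/

section Relation

variable {F : Type*} [Field F] [ValuativeRel F] [TopologicalSpace F] [IsNonarchimedeanLocalField F]
  {n r : ℕ} (c : Fin n → Fin r)

/-- **Every homomorphism `GL_N(F) →* A` to a commutative group kills `U_N`** (`U_N` is the
unipotent radical of the Borel `P_id`; `map_eq_one_of_mem_unipotentRadicalP`). [folklore] -/
theorem map_upperUnitriangular_eq_one_of_commGroup {N : ℕ} {A : Type*} [CommGroup A]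
    (χ : GL (Fin N) F →* A) {u : GL (Fin N) F} (hu : u ∈ upperUnitriangular (Fin N) F) : χ u = 1 := by
  obtain ⟨q, hq, rfl⟩ := hu
  exact map_eq_one_of_mem_unipotentRadicalP (id : Fin N → Fin N)
    (χ.comp (standardParabolicGL F (id : Fin N → Fin N)).subtype) (exists_ne_zero_and_ne_one F) hq

/-- **`δ_{P_c}^{1/2}` is trivial on `diag(1, …, g, …, 1)` for `g = ẽ_a u ẽ_a⁻¹`, `u ∈ U_{n_a}`.**
[folklore] -/
theorem rootDeltaChar_leviEmbeddingP_mulSingle_eq_one (a : Fin r)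
    {u : GL (Fin (Fintype.card {i // c i = a})) F} (hu : u ∈ upperUnitriangular _ F) :
    rootDeltaChar (standardParabolicGL F c)
      (leviEmbeddingP F c (Pi.mulSingle a (reindexGL (k := F) (blockEnumRev c a) u))) = 1 := by
  let χ : GL (Fin (Fintype.card {i // c i = a})) F →* ℂˣ :=
    (rootDeltaChar (standardParabolicGL F c)).comp ((leviEmbeddingP F c).comp
      ((MonoidHom.mulSingle (fun b => GL {i // c i = b} F) a).comp (reindexGL (k := F) (blockEnumRev c a)).toMonoidHom))
  exact map_upperUnitriangular_eq_one_of_commGroup χ hu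

variable {W : Type*} [AddCommGroup W] [Module ℂ W]
  (σ : Representation ℂ (Π a, GL {i // c i = a} F) W) (ψ : AddChar F Circle)

/-- **The Levi relation block by block.** Let `c` be monotone and `l` a linear form on `W`
satisfying the cell relation `l (σ'(w₀ m w₀⁻¹) w) = ψ_U(m) l w` for all `m ∈ A'`, where
`σ' = (σ ∘ proj_c) ⊗ δ_{P_c}^{1/2}` is the inducing datum of `i_c σ`. Then for every block `a` and
every `u ∈ U_{n_a}(F)`, `l (σ (mulSingle a (ẽ_a u ẽ_a⁻¹)) w) = ψ_{U_{n_a}}(u) · l w`.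
(Take `m = cellLeviElt c a u ∈ A'`: `w₀ m w₀⁻¹ = diag(1, …, ẽ_a u ẽ_a⁻¹, …, 1)`, on which `δ^{1/2}`
is trivial and `proj_c` is `mulSingle a (ẽ_a u ẽ_a⁻¹)`, and `ψ_U(m) = ψ_{U_{n_a}}(u)`.)
(Bernstein–Zelevinsky 1977, §4.7.) [cite: BernsteinZelevinskyASENS1977, §4.7] -/
theorem apply_mulSingle_reindexGL_of_cell_relation (hc : Monotone c) (l : Module.Dual ℂ W)
    (hl : ∀ (m : GL (Fin n) F) (hm : m ∈ cellLeviUnipotent (K := F) c) (w : W),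
      l (Representation.twist (σ.comp (leviProjection F c)) (rootDeltaChar (standardParabolicGL F c))
        ⟨permGL Fin.revPerm * m * (permGL Fin.revPerm)⁻¹,
          conj_mem_standardParabolicGL_of_mem_cellLeviUnipotent c hm⟩ w) =
        whittakerCharFun ψ ⟨m, cellLeviUnipotent_le c hm⟩ * l w)
    (a : Fin r) (u : ↥(upperUnitriangular (Fin (Fintype.card {i // c i = a})) F)) (w : W) :
    l (σ (Pi.mulSingle a (reindexGL (k := F) (blockEnumRev c a) (u : GL _ F))) w) =
      whittakerCharFun ψ u * l w := by
  have hm := cellLeviElt_mem_cellLeviUnipotent (c := c) a u.2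
  have h := hl _ hm w
  have hP : (⟨permGL Fin.revPerm * cellLeviElt c a (u : GL _ F) * (permGL Fin.revPerm)⁻¹,
      conj_mem_standardParabolicGL_of_mem_cellLeviUnipotent c hm⟩ : ↥(standardParabolicGL F c)) =
      leviEmbeddingP F c (Pi.mulSingle a (reindexGL (k := F) (blockEnumRev c a) (u : GL _ F))) :=
    Subtype.ext (permGL_mul_cellLeviElt_mul_inv a _)
  rw [hP, Representation.twist_apply, rootDeltaChar_leviEmbeddingP_mulSingle_eq_one c a u.2, Units.val_one,
    one_smul, MonoidHom.comp_apply, leviProjection_leviEmbeddingP_apply] at h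
  rw [h]
  congr 1
  exact whittakerCharFun_cellLeviElt hc ψ a u

end Relation

end Literature.NumberTheory.Automorphic
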